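import Summits.AtomisticToContinuum.Crystallization.Theses.PhononSlackCertificates
import Summits.AtomisticToContinuum.Crystallization.Theorems.PhononSlackCertificatesPeriodicGivenLayeredClosing3
import Summits.AtomisticToContinuum.Crystallization.Theorems.PhononSlackCertificatesPeriodicGivenLayeredClosing5

/-!
# `PeriodicGivenLayered` (stmt-AtomisticToContinuum-11779), line `Sketch`, stub `stub_closing` — part 6

**Part B of the density closing: a fault-free uniformly recurrent layered set in the hull of a
sequence of Lennard-Jones ground states has constant increments** (lead
prover-line-stmt-AtomisticToContinuum-11779-0).

If two consecutive increments differ, `|Δ m₀ − Δ (m₀+1)| = 4η₀ > 0`, uniform recurrence (block length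
`2`, tolerance `η₀`) makes the event `|Δ m − Δ (m+1)| ≥ 2η₀` recur in every window of `G + 1` layers, so
among the first `n = n''(G+1)` increments it happens `≥ n''` times (`clo_count`) and
`Σ_{i<n} (Δ i − Δ (i+1))² ≥ 4η₀² n''`. Compare three prisms of `n + 1` layers and `K = n + 1` columns:
the prisms at `m₁ = 0` and `m₁ = 1` of the given set `S` (hull upper bound (U) of `stub_windowBounds`)
and the prism at `m₁ = 0` of the layered set with the AVERAGED heights `ẑ m = (z m + z (m+1))/2` (same
word, same `a, A`; free lower bound (L)), all of cardinality `(n+1)K²`, so that `2E((n+1)K²)` cancels.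
By the layer cake the three site-energy sums are `K² Σ_m (Φ₀ + T(m))`; by the block decomposition
(part 5) `Σ_m T(m) = 2F_n(Δ) + O(C)` with the increment vectors `Δ`, its shift, and their midpoint; the
increment convexity of `stub_convexity` gives `F(Δ) + F(Δ') − 2F((Δ+Δ')/2) ≥ κ Σ (Δ i − Δ' i)²`. Hence
`8κη₀² n'' K² ≤ (4|C_U| + 4|C_L| + 64)·C·K²`, absurd for `n''` large (`clo_partB`).
-/

noncomputable section

namespace Summit.AtomisticToContinuum.Crystallization.Theorems.LayeredHull

open scoped BigOperators
open Finset Filter Literature.MathematicalPhysics.StatisticalMechanics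

/-- Sums of `c + f m` over an integer interval of length `k`. [folklore] -/
theorem clo_sum_const_add (c : ℝ) (f : ℤ → ℝ) (m₁ : ℤ) (k : ℕ) :
    ∑ m ∈ Finset.Ico m₁ (m₁ + k), (c + f m) = k * c + ∑ m ∈ Finset.Ico m₁ (m₁ + k), f m := by
  rw [Finset.sum_add_distrib, Finset.sum_const, Int.card_Ico, nsmul_eq_mul]
  congr 2
  simp

/-- Squares dominate the recurrent event: if `2η ≤ |x|` then `4η² ≤ x²`, else `0 ≤ x²`. [folklore] -/
theorem clo_sq_ge_indicator (η x : ℝ) (hη : 0 ≤ η) :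
    4 * η ^ 2 * (if 2 * η ≤ |x| then (1 : ℝ) else 0) ≤ x ^ 2 := by
  split_ifs with h
  · have : (2 * η) ^ 2 ≤ |x| ^ 2 := pow_le_pow_left₀ (by linarith) h 2
    rw [sq_abs] at this
    linarith
  · simp only [mul_zero]; positivity

/-- **Part B of the closing.** A fault-free uniformly recurrent layered set in the hull of a sequence of
Lennard-Jones ground states has constant increments, given the window bounds (U), (L), the registry
facts, the increment convexity and the layer cake (hypotheses verbatim as in `stub_closing`) and the
conclusion of Part A (`hA`). [folklore] -/
theorem clo_partB (x : (N : ℕ) → (Fin N → (EuclideanSpace ℝ (Fin 3)))) (hx : ∀ N, IsGroundState lennardJones (x N))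
    (a : ℝ) (ha : 47 / 50 ≤ a) (ha1 : a ≤ 1) (A : (EuclideanSpace ℝ (Fin 3)) →ₗᵢ[ℝ] (EuclideanSpace ℝ (Fin 3))) (s : ℤ → ℤ) (z : ℤ → ℝ)
    (hs : IsHaggSeq s) (hz : ∀ m : ℤ, 39 / 50 * a ≤ z (m + 1) - z m ∧ z (m + 1) - z m ≤ 17 / 20 * a)
    (hrec : ∀ (n : ℕ) (η : ℝ), 0 < η → ∀ m₀ : ℤ, ∃ G : ℕ, ∀ m : ℤ, ∃ g : ℤ, 0 ≤ g ∧ g ≤ G ∧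
      ∀ k : ℕ, k < n → s (m + g + k) = s (m₀ + k) ∧
        |(z (m + g + k + 1) - z (m + g + k)) - (z (m₀ + k + 1) - z (m₀ + k))| ≤ η)
    (hH : let S : Set (EuclideanSpace ℝ (Fin 3)) := {p | ∃ m i j : ℤ, p = A (((i : ℝ) • triangularVec₁ a) +
        ((j : ℝ) • triangularVec₂ a) + ((haggLabel s m : ℝ) • barlowOffset a) + (z m • layerNormal 1))};
      ∀ R ε : ℝ, 0 < ε → ∃ᶠ N in atTop, ∃ t : (EuclideanSpace ℝ (Fin 3)),
        (∀ p ∈ S, ‖p‖ ≤ R → ∃ i : Fin N, dist (x N i + t) p ≤ ε) ∧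
        (∀ i : Fin N, ‖x N i + t‖ ≤ R → ∃ p ∈ S, dist (x N i + t) p ≤ ε))
    (hU : ∃ C : ℝ, ∀ x : (N : ℕ) → (Fin N → (EuclideanSpace ℝ (Fin 3))), (∀ N, IsGroundState lennardJones (x N)) →
      ∀ S : Set (EuclideanSpace ℝ (Fin 3)), (∀ R ε : ℝ, 0 < ε → ∃ᶠ N in atTop, ∃ t : (EuclideanSpace ℝ (Fin 3)),
        (∀ p ∈ S, ‖p‖ ≤ R → ∃ i : Fin N, dist (x N i + t) p ≤ ε) ∧
        (∀ i : Fin N, ‖x N i + t‖ ≤ R → ∃ p ∈ S, dist (x N i + t) p ≤ ε)) →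
      ∀ W : Finset (EuclideanSpace ℝ (Fin 3)), (↑W : Set (EuclideanSpace ℝ (Fin 3))) ⊆ S →
        ∑ p ∈ W, (∑' q : {q : (EuclideanSpace ℝ (Fin 3)) // q ∈ S ∧ q ≠ p}, lennardJones (dist p (q : (EuclideanSpace ℝ (Fin 3))))) ≤
          2 * groundStateEnergy lennardJones 3 W.card +
            C * ∑ p ∈ W, (1 + Metric.infDist p (S \ (↑W : Set (EuclideanSpace ℝ (Fin 3)))))⁻¹ ^ 3)
    (hL : ∀ δ : ℝ, 0 < δ → ∃ C : ℝ, ∀ S : Set (EuclideanSpace ℝ (Fin 3)), (∀ p ∈ S, ∀ q ∈ S, p ≠ q → δ ≤ dist p q) →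
      ∀ W : Finset (EuclideanSpace ℝ (Fin 3)), (↑W : Set (EuclideanSpace ℝ (Fin 3))) ⊆ S →
        2 * groundStateEnergy lennardJones 3 W.card -
            C * ∑ p ∈ W, (1 + Metric.infDist p (S \ (↑W : Set (EuclideanSpace ℝ (Fin 3)))))⁻¹ ^ 3 ≤
          ∑ p ∈ W, (∑' q : {q : (EuclideanSpace ℝ (Fin 3)) // q ∈ S ∧ q ≠ p}, lennardJones (dist p (q : (EuclideanSpace ℝ (Fin 3))))))
    (_hreg : ∃ c₀ : ℝ, 0 < c₀ ∧ ∀ a : ℝ, 47 / 50 ≤ a → a ≤ 1 →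
      (∀ H H' : ℝ, 39 / 25 * a ≤ H → H ≤ H' →
        barlowCoupling lennardJones a H' 1 ≤ 0 ∧
          barlowCoupling lennardJones a H 1 ≤ barlowCoupling lennardJones a H' 1) ∧
      c₀ ≤ barlowCoupling lennardJones a (117 / 50 * a) 1 - barlowCoupling lennardJones a (17 / 10 * a) 1)
    (hconv : ∃ κ : ℝ, 0 < κ ∧ ∀ a : ℝ, 47 / 50 ≤ a → a ≤ 1 → ∀ (n : ℕ) (Δ Δ' : ℕ → ℝ),
      (∀ i, i < n → 39 / 50 * a ≤ Δ i ∧ Δ i ≤ 17 / 20 * a) →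
      (∀ i, i < n → 39 / 50 * a ≤ Δ' i ∧ Δ' i ≤ 17 / 20 * a) →
      κ * ∑ i ∈ Finset.range n, (Δ i - Δ' i) ^ 2 ≤
        (∑ i ∈ Finset.range n, ∑ j ∈ Finset.Ioc i n, layerInteraction lennardJones a
            (∑ l ∈ Finset.Ico i j, Δ l) (if Even (j - i) then 0 else 1) 1) +
        (∑ i ∈ Finset.range n, ∑ j ∈ Finset.Ioc i n, layerInteraction lennardJones a
            (∑ l ∈ Finset.Ico i j, Δ' l) (if Even (j - i) then 0 else 1) 1) -
        2 * (∑ i ∈ Finset.range n, ∑ j ∈ Finset.Ioc i n, layerInteraction lennardJones a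
            (∑ l ∈ Finset.Ico i j, (Δ l + Δ' l) / 2) (if Even (j - i) then 0 else 1) 1))
    (hcake : ∃ C : ℝ, ∀ a : ℝ, 47 / 50 ≤ a → a ≤ 1 →
      (∀ (H : ℝ) (δ : ℤ), 7 / 10 ≤ |H| → |layerInteraction lennardJones a H δ 1| ≤ C / H ^ 4) ∧
      ∀ (A : (EuclideanSpace ℝ (Fin 3)) →ₗᵢ[ℝ] (EuclideanSpace ℝ (Fin 3))) (s : ℤ → ℤ) (z : ℤ → ℝ), IsHaggSeq s →
        (∀ m : ℤ, 39 / 50 * a ≤ z (m + 1) - z m ∧ z (m + 1) - z m ≤ 17 / 20 * a) →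
        let S : Set (EuclideanSpace ℝ (Fin 3)) := {p | ∃ m i j : ℤ, p = A (((i : ℝ) • triangularVec₁ a) +
          ((j : ℝ) • triangularVec₂ a) + ((haggLabel s m : ℝ) • barlowOffset a) + (z m • layerNormal 1))};
        (∀ p ∈ S, ∀ q ∈ S, p ≠ q → 1 / 2 ≤ dist p q) ∧
        (∀ m : ℤ, Summable fun m' : ℤ => if m' = m then (0 : ℝ) else
          layerInteraction lennardJones a (z m' - z m) (haggLabel s m' - haggLabel s m) 1) ∧
        (∀ m i j : ℤ,
          (∑' q : {q : (EuclideanSpace ℝ (Fin 3)) // q ∈ S ∧ q ≠ A (((i : ℝ) • triangularVec₁ a) + ((j : ℝ) • triangularVec₂ a) +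
              ((haggLabel s m : ℝ) • barlowOffset a) + (z m • layerNormal 1))},
            lennardJones (dist (A (((i : ℝ) • triangularVec₁ a) + ((j : ℝ) • triangularVec₂ a) +
              ((haggLabel s m : ℝ) • barlowOffset a) + (z m • layerNormal 1))) (q : (EuclideanSpace ℝ (Fin 3))))) =
          inLayerInteraction lennardJones a + ∑' m' : ℤ, if m' = m then (0 : ℝ) else
            layerInteraction lennardJones a (z m' - z m) (haggLabel s m' - haggLabel s m) 1) ∧
        (∀ (m₁ : ℤ) (n K : ℕ),
          let W : Finset (EuclideanSpace ℝ (Fin 3)) := ((Finset.Ico m₁ (m₁ + n)) ×ˢ ((Finset.range K) ×ˢ (Finset.range K))).image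
            fun t : ℤ × (ℕ × ℕ) => A (((((t.2.1 : ℤ) - haggLabel s t.1 / 3 : ℤ) : ℝ) • triangularVec₁ a) +
              ((((t.2.2 : ℤ) - haggLabel s t.1 / 3 : ℤ) : ℝ) • triangularVec₂ a) +
              ((haggLabel s t.1 : ℝ) • barlowOffset a) + (z t.1 • layerNormal 1));
          (↑W : Set (EuclideanSpace ℝ (Fin 3))) ⊆ S ∧ W.card = n * K ^ 2 ∧
          (∑ p ∈ W, (∑' q : {q : (EuclideanSpace ℝ (Fin 3)) // q ∈ S ∧ q ≠ p}, lennardJones (dist p (q : (EuclideanSpace ℝ (Fin 3)))))) =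
            (K : ℝ) ^ 2 * ∑ m ∈ Finset.Ico m₁ (m₁ + n), (inLayerInteraction lennardJones a +
              ∑' m' : ℤ, if m' = m then (0 : ℝ) else
                layerInteraction lennardJones a (z m' - z m) (haggLabel s m' - haggLabel s m) 1) ∧
          (∑ p ∈ W, (1 + Metric.infDist p (S \ (↑W : Set (EuclideanSpace ℝ (Fin 3)))))⁻¹ ^ 3) ≤ C * (n * K + K ^ 2)))
    (hA : ∀ m : ℤ, s (m + 1) = -s m) :
    ∀ m : ℤ, z (m + 2) - z (m + 1) = z (m + 1) - z m := by
  classical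
  by_contra hcon
  simp only [not_forall] at hcon
  obtain ⟨m₀, hm₀⟩ := hcon
  -- the recurrent event
  set η₀ : ℝ := |(z (m₀ + 1) - z m₀) - (z (m₀ + 2) - z (m₀ + 1))| / 4 with hη₀
  have hη₀pos : 0 < η₀ := by
    have : (z (m₀ + 1) - z m₀) - (z (m₀ + 2) - z (m₀ + 1)) ≠ 0 := fun h => hm₀ (by linarith)
    have := abs_pos.2 this
    rw [hη₀]; linarith
  obtain ⟨G, hG⟩ := hrec 2 η₀ hη₀pos m₀
  have hevent : ∀ m : ℤ, ∃ g : ℤ, 0 ≤ g ∧ g ≤ G ∧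
      2 * η₀ ≤ |(z (m + g + 1) - z (m + g)) - (z (m + g + 2) - z (m + g + 1))| := by
    intro m
    obtain ⟨g, hg0, hgG, hk⟩ := hG m
    refine ⟨g, hg0, hgG, ?_⟩
    have h0 := (hk 0 (by norm_num)).2
    have h1 := (hk 1 (by norm_num)).2
    simp only [Nat.cast_zero, add_zero, Nat.cast_one] at h0 h1
    have e1 : m + g + 1 + 1 = m + g + 2 := by ring
    have e2 : m₀ + 1 + 1 = m₀ + 2 := by ring
    rw [e1, e2] at h1
    have h4 : 4 * η₀ = |(z (m₀ + 1) - z m₀) - (z (m₀ + 2) - z (m₀ + 1))| := by rw [hη₀]; ring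
    -- triangle inequality
    have := abs_sub_abs_le_abs_sub ((z (m₀ + 1) - z m₀) - (z (m₀ + 2) - z (m₀ + 1)))
      ((z (m + g + 1) - z (m + g)) - (z (m + g + 2) - z (m + g + 1)))
    have hx : |(z (m₀ + 1) - z m₀) - (z (m₀ + 2) - z (m₀ + 1)) -
        ((z (m + g + 1) - z (m + g)) - (z (m + g + 2) - z (m + g + 1)))| ≤ 2 * η₀ := by
      have e : (z (m₀ + 1) - z m₀) - (z (m₀ + 2) - z (m₀ + 1)) -
          ((z (m + g + 1) - z (m + g)) - (z (m + g + 2) - z (m + g + 1))) =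
          -((z (m + g + 1) - z (m + g)) - (z (m₀ + 1) - z m₀)) +
            ((z (m + g + 2) - z (m + g + 1)) - (z (m₀ + 2) - z (m₀ + 1))) := by ring
      rw [e]
      refine (abs_add_le _ _).trans ?_
      rw [abs_neg]
      linarith
    linarith
  -- unpack the constants
  obtain ⟨CU, hU'⟩ := hU
  obtain ⟨CL, hL'⟩ := hL (1 / 2) (by norm_num)
  obtain ⟨κ, hκ, hconv'⟩ := hconv
  have hconvA := hconv' a ha ha1
  obtain ⟨Cc, hcake'⟩ := hcake
  obtain ⟨hdecay, hcakeA⟩ := hcake' a ha ha1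
  obtain ⟨-, hsumS, -, hprismS⟩ := hcakeA A s z hs hz
  have hCc : 0 ≤ Cc := by
    have h1 := hdecay 1 0 (by norm_num)
    have : (0 : ℝ) ≤ Cc / 1 ^ 4 := (abs_nonneg _).trans h1
    simpa using this
  -- the averaged heights
  have hzh : ∀ m : ℤ, 39 / 50 * a ≤ (z (m + 1) + z (m + 1 + 1)) / 2 - (z m + z (m + 1)) / 2 ∧
      (z (m + 1) + z (m + 1 + 1)) / 2 - (z m + z (m + 1)) / 2 ≤ 17 / 20 * a := by
    intro m
    have h1 := hz m
    have h2 := hz (m + 1)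
    constructor <;> linarith [h1.1, h1.2, h2.1, h2.2]
  obtain ⟨hsepH, hsumH, -, hprismH⟩ := hcakeA A s (fun m => (z m + z (m + 1)) / 2) hs hzh
  -- the number of blocks `n''`, the block `n = n''(G+1)` increments, `K = n + 1`
  obtain ⟨n'', hn''⟩ := exists_nat_gt ((4 * |CU| + 4 * |CL| + 64) * Cc / (8 * κ * η₀ ^ 2))
  set n : ℕ := n'' * (G + 1) with hn
  -- the three prisms
  obtain ⟨hW1sub, hW1card, hW1sum, hW1bd⟩ := hprismS 0 (n + 1) (n + 1)
  obtain ⟨hW2sub, hW2card, hW2sum, hW2bd⟩ := hprismS 1 (n + 1) (n + 1)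
  obtain ⟨hWhsub, hWhcard, hWhsum, hWhbd⟩ := hprismH 0 (n + 1) (n + 1)
  have hU1 := hU' x hx _ hH _ hW1sub
  have hU2 := hU' x hx _ hH _ hW2sub
  have hLh := hL' _ hsepH _ hWhsub
  rw [hW1card, hW1sum] at hU1
  rw [hW2card, hW2sum] at hU2
  rw [hWhcard, hWhsum] at hLh
  have hU1' := clo_absorb_upper hU1 hW1bd (Finset.sum_nonneg fun p _ =>
    pow_nonneg (inv_nonneg.2 (add_nonneg zero_le_one Metric.infDist_nonneg)) 3)
  have hU2' := clo_absorb_upper hU2 hW2bd (Finset.sum_nonneg fun p _ =>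
    pow_nonneg (inv_nonneg.2 (add_nonneg zero_le_one Metric.infDist_nonneg)) 3)
  have hLh' := clo_absorb_lower hLh hWhbd (Finset.sum_nonneg fun p _ =>
    pow_nonneg (inv_nonneg.2 (add_nonneg zero_le_one Metric.infDist_nonneg)) 3)
  clear hU1 hU2 hLh hW1bd hW2bd hWhbd hW1sub hW2sub hWhsub hW1card hW2card hWhcard hW1sum hW2sum hWhsum
  rw [clo_sum_const_add] at hU1' hU2' hLh'
  -- block decompositions
  have hB1 := clo_block_decomposition ha hs hA hz hdecay hsumS 0 n
  have hB2 := clo_block_decomposition ha hs hA hz hdecay hsumS 1 n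
  have hBh := clo_block_decomposition (z := fun m => (z m + z (m + 1)) / 2) ha hs hA hzh hdecay hsumH 0 n
  rw [abs_le] at hB1 hB2 hBh
  -- increment convexity for `Δ` and its shift
  have hcv := hconvA n (fun l : ℕ => z (0 + (l : ℤ) + 1) - z (0 + (l : ℤ)))
    (fun l : ℕ => z (1 + (l : ℤ) + 1) - z (1 + (l : ℤ)))
    (fun i _ => hz (0 + (i : ℤ))) (fun i _ => hz (1 + (i : ℤ)))
  -- the midpoint block energy is the block energy of the averaged heights
  have hmid : (∑ i ∈ Finset.range n, ∑ j ∈ Finset.Ioc i n, layerInteraction lennardJones a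
          (∑ l ∈ Finset.Ico i j, ((z (0 + (l : ℤ) + 1) - z (0 + (l : ℤ)) + (z (1 + (l : ℤ) + 1) - z (1 + (l : ℤ)))) / 2)) (if Even (j - i) then 0 else 1) 1) = (∑ i ∈ Finset.range n, ∑ j ∈ Finset.Ioc i n, layerInteraction lennardJones a
          (∑ l ∈ Finset.Ico i j, ((z (0 + (l : ℤ) + 1) + z (0 + (l : ℤ) + 1 + 1)) / 2 - (z (0 + (l : ℤ)) + z (0 + (l : ℤ) + 1)) / 2)) (if Even (j - i) then 0 else 1) 1) := by
    refine Finset.sum_congr rfl fun i _ => Finset.sum_congr rfl fun j _ => ?_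
    congr 1
    refine Finset.sum_congr rfl fun l _ => ?_
    have e1 : z (1 + (l : ℤ) + 1) = z (0 + (l : ℤ) + 1 + 1) := congr_arg z (by ring)
    have e2 : z (1 + (l : ℤ)) = z (0 + (l : ℤ) + 1) := congr_arg z (by ring)
    rw [e1, e2]
    ring
  rw [hmid] at hcv
  -- counting the recurrent event among the first `n` increments
  have hcount : (n'' : ℝ) ≤ ∑ i ∈ Finset.range n,
      (if 2 * η₀ ≤ |(z (0 + (i : ℤ) + 1) - z (0 + (i : ℤ))) - (z (0 + (i : ℤ) + 2) - z (0 + (i : ℤ) + 1))|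
        then (1 : ℝ) else 0) := by
    have := clo_count (fun m : ℤ => 2 * η₀ ≤ |(z (m + 1) - z m) - (z (m + 2) - z (m + 1))|) G 0
      (fun m => hevent m) n''
    rw [clo_sum_Ico_eq_sum_range] at this
    exact this
  have hQ : 4 * η₀ ^ 2 * n'' ≤ ∑ i ∈ Finset.range n,
      ((z (0 + (i : ℤ) + 1) - z (0 + (i : ℤ))) - (z (1 + (i : ℤ) + 1) - z (1 + (i : ℤ)))) ^ 2 := by
    have h1 : 4 * η₀ ^ 2 * (n'' : ℝ) ≤ 4 * η₀ ^ 2 * ∑ i ∈ Finset.range n,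
        (if 2 * η₀ ≤ |(z (0 + (i : ℤ) + 1) - z (0 + (i : ℤ))) - (z (0 + (i : ℤ) + 2) - z (0 + (i : ℤ) + 1))|
          then (1 : ℝ) else 0) := mul_le_mul_of_nonneg_left hcount (by positivity)
    refine h1.trans ?_
    rw [Finset.mul_sum]
    refine Finset.sum_le_sum fun i _ => ?_
    have e1 : z (1 + (i : ℤ) + 1) = z (0 + (i : ℤ) + 2) := congr_arg z (by ring)
    have e2 : z (1 + (i : ℤ)) = z (0 + (i : ℤ) + 1) := congr_arg z (by ring)
    rw [e1, e2]
    exact clo_sq_ge_indicator η₀ _ hη₀pos.le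
  -- the energy inequality, multiplied out
  have ht : (0 : ℝ) < ((n + 1 : ℕ) : ℝ) := by positivity
  have ht2 : (0 : ℝ) < ((n + 1 : ℕ) : ℝ) ^ 2 := by positivity
  have key : ((n + 1 : ℕ) : ℝ) ^ 2 * (8 * κ * η₀ ^ 2 * n'') ≤
      ((n + 1 : ℕ) : ℝ) ^ 2 * ((4 * |CU| + 4 * |CL| + 64) * Cc) := by
    have m1 := mul_le_mul_of_nonneg_left hB1.1 ht2.le
    have m2 := mul_le_mul_of_nonneg_left hB2.1 ht2.le
    have m3 := mul_le_mul_of_nonneg_left hBh.2 ht2.le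
    have m4 := mul_le_mul_of_nonneg_left hcv ht2.le
    have m5 := mul_le_mul_of_nonneg_left hQ (show (0 : ℝ) ≤ ((n + 1 : ℕ) : ℝ) ^ 2 * κ by positivity)
    nlinarith [m1, m2, m3, m4, m5, hU1', hU2', hLh', abs_nonneg CU, abs_nonneg CL, hCc]
  have key' : 8 * κ * η₀ ^ 2 * n'' ≤ (4 * |CU| + 4 * |CL| + 64) * Cc := le_of_mul_le_mul_left key ht2
  have hpos : 0 < 8 * κ * η₀ ^ 2 := by positivity
  have : (n'' : ℝ) ≤ (4 * |CU| + 4 * |CL| + 64) * Cc / (8 * κ * η₀ ^ 2) := by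
    rw [le_div_iff₀ hpos]; linarith
  linarith

end Summit.AtomisticToContinuum.Crystallization.Theorems.LayeredHull

end
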